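import Summits.QuantumFields.BalabanUV.T4Continuum.Support.NE3FramePotBound
import HarnessLib

/-!
# T⁴ programme, node NE3, row E-MLw-(w4)-P · H4-ℂ — NATURALITY OF THE LINEARISED AVERAGING OBJECTS UNDER ℂ-LINEAR MAPS,
# AND THE CRUDE FRAME BOUND FOR COMPLEX-VALUED 1-FORMS (the `hF` input of the (P♮)-flat assembly socket)

NE3 formalisation swarm `b2b-balaban-t4-ne3-formalise-*`, LEAF PROVER 04 (gen 5), row **H4-ℂ** of the owner's ruling ρ-g22-1 (R5)
(`t4-ne3-p1-g22`, HOME/CLAIMS.log l.16859: «H4-ℂ twin → leaf-04: corollary of p225364 by the diagonal embedding, or file 2»; answer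
l.16685: «the H5 assembly runs ENTRYWISE OVER ℂ … the shape the competitor consumes is the ℂ-valued twin
`∀ η : Site d → Fin d → ℂ, (L^k·N)-periodic → Σ_{z∈periodBox N} ‖framePot L k η z‖² ≤ 12·Dfp d L·Σ_{x∈periodBox (L^k·N)} Σ_κ ‖η x κ‖²`»).

CONTENT (all [folklore]; 0 sorry; 0 def):
§1 NATURALITY — for a ℂ-linear map `φ : 𝔸 →ₗ[ℂ] 𝔹` between complex normed algebras and a 1-form `A : Site d → Fin d → 𝔸`, every
   linearised block-averaging object of the tree commutes with `φ` applied coefficientwise (`fun x κ ↦ φ (A x κ)`): `stepA_map`,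
   `asum_map` (B7 `B7Prop1Explicit.stepA`∕`asum`), `Tside_map`, `Fhat_map`, `linQ_map` (B7 `Tside`, `B7Prop3Flat.Fhat`∕`linQ`), `Tcoarse_map`,
   `Qcoarse_map`, `Fcoarse_map`, `iterate_Qcoarse_map`, `iterate_Tcoarse_map`, `dPot_map`, **`framePot_map`** (this unit's file (A)
   `NE3TangentFlatStructure.framePot`, p219035) — finite sums, signs and real scalars only (`map_real_smul`: a ℂ-linear map commutes with
   the real scalars of `Module.complexToReal`).
§2 **`sum_norm_framePot_sq_le_complex`** — for `3 ≤ d`, `2 ≤ L`, `1 ≤ N`, `k`, and an `(L^k·N)`-periodic `η : Site d → Fin d → ℂ`: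
   `Σ_{z∈periodBox N} ‖framePot L k η z‖² ≤ 12·Dfp d L·Σ_{x∈periodBox (L^k·N)} Σ_κ ‖η x κ‖²` — LITERALLY the hypothesis `hF` (with
   `CF := 12·Dfp d L`, `0 ≤ CF` = `twelve_mul_Dfp_nonneg`) of the owner's socket `NE3SlicePoincareAssembly.sum_norm_sq_le_of_split_interp_frame`
   (H5a); proof = the matrix theorem `NE3FramePotBound.sum_norm_framePot_sq_le` (p225364) at `n = Fin 1` through the isometric diagonal
   embedding `algebraMap ℂ (Matrix (Fin 1) (Fin 1) ℂ)` (`norm_algebraMap'`, ℓ²-operator norm) and §1.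

HONEST: flat-lattice kinematics on OUR frame (bookkeeping); constant crude but k-FREE and N-FREE; nothing about minimisers, (P♮), (ML_w), T-E_w
or NE3 is asserted; NE3 NOT proved; spine 0∕9; finite T⁴ rung (B)+1 — NOT infinite volume, NOT mass gap, NOT BetaPertH, NOT Clay.
PLACEMENT: `Summits/QuantumFields/BalabanUV/` (our frame, no published statement reproduced).
-/

set_option autoImplicit false

open scoped BigOperators Matrix.Norms.L2Operator
open Finset

namespace Summit.QuantumFields.BalabanUV.T4Continuum.NE3FramePotBoundComplex

open Literature.MathematicalPhysics.QuantumFieldTheory.Balaban1983to89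
open B7Prop1Explicit B7Prop3Flat
open T4AveragingDeficitWallBoundary (periodBox)
open AveragingDeficitPeriodicCounting (IsPeriodicDir)
open NE3TangentNoGoWords (dPot)
open SmoothRefineNeutral (Tcoarse)
open NE3TangentFlatStructure (Qcoarse Fcoarse framePot framePot_succ framePot_zero)
open NE3CovariantLineSumsL2 (l2sq)
open NE3FramePotBound (Dfp sum_norm_framePot_sq_le)

noncomputable section

variable {d : ℕ}

/-! ## §1 Naturality under ℂ-linear coefficient maps -/

section Naturality

variable {𝔸 𝔹 : Type*} [NormedRing 𝔸] [NormedAlgebra ℂ 𝔸] [NormedRing 𝔹] [NormedAlgebra ℂ 𝔹]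

/-- A ℂ-linear map commutes with the real scalars (`Module.complexToReal`). [folklore] -/
theorem map_real_smul (φ : 𝔸 →ₗ[ℂ] 𝔹) (r : ℝ) (a : 𝔸) : φ (r • a) = r • φ a := by
  rw [← Complex.coe_smul, map_smul, Complex.coe_smul]

/-- Naturality of the letter contribution `stepA`. [folklore] -/
theorem stepA_map (φ : 𝔸 →ₗ[ℂ] 𝔹) (A : Site d → Fin d → 𝔸) (x : Site d) (l : Letter d) :
    stepA (fun y κ => φ (A y κ)) x l = φ (stepA A x l) := by
  unfold stepA
  split_ifs
  · rfl
  · rw [map_neg]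

/-- Naturality of the abelian path functional `asum`. [folklore] -/
theorem asum_map (φ : 𝔸 →ₗ[ℂ] 𝔹) (A : Site d → Fin d → 𝔸) : ∀ (x : Site d) (w : List (Letter d)),
    asum (fun y κ => φ (A y κ)) x w = φ (asum A x w)
  | x, [] => by rw [asum_nil, asum_nil, map_zero]
  | x, l :: w => by rw [asum_cons, asum_cons, stepA_map, asum_map φ A (x + l.vec) w, map_add]

/-- Naturality of the one-bond first-order term `Tside`. [folklore] -/
theorem Tside_map (φ : 𝔸 →ₗ[ℂ] 𝔹) (L : ℕ) (A : Site d → Fin d → 𝔸) (q : Site d) (κ : Fin d) :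
    Tside L (fun y μ => φ (A y μ)) q κ = φ (Tside L A q κ) := by
  unfold Tside
  rw [map_sum]
  exact Finset.sum_congr rfl fun r _ => by rw [map_real_smul, asum_map]

/-- Naturality of the block frame exponent `Fhat`. [folklore] -/
theorem Fhat_map (φ : 𝔸 →ₗ[ℂ] 𝔹) (L : ℕ) (A : Site d → Fin d → 𝔸) (q : Site d) :
    Fhat L (fun y μ => φ (A y μ)) q = φ (Fhat L A q) := by
  unfold Fhat
  rw [map_sum]
  exact Finset.sum_congr rfl fun r _ => by rw [map_real_smul, asum_map]

/-- Naturality of the straight block line average `linQ`. [folklore] -/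
theorem linQ_map (φ : 𝔸 →ₗ[ℂ] 𝔹) (L : ℕ) (A : Site d → Fin d → 𝔸) (q : Site d) (κ : Fin d) :
    linQ L (fun y μ => φ (A y μ)) q κ = φ (linQ L A q κ) := by
  unfold linQ
  rw [map_sum]
  exact Finset.sum_congr rfl fun r _ => by rw [map_real_smul, asum_map]

/-- Naturality of `Tcoarse`. [folklore] -/
theorem Tcoarse_map (φ : 𝔸 →ₗ[ℂ] 𝔹) (L : ℕ) (A : Site d → Fin d → 𝔸) (z : Site d) (κ : Fin d) :
    Tcoarse L (fun y μ => φ (A y μ)) z κ = φ (Tcoarse L A z κ) := by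
  unfold Tcoarse; exact Tside_map φ L A _ κ

/-- Naturality of `Qcoarse`. [folklore] -/
theorem Qcoarse_map (φ : 𝔸 →ₗ[ℂ] 𝔹) (L : ℕ) (A : Site d → Fin d → 𝔸) :
    Qcoarse L (fun y μ => φ (A y μ)) = fun z κ => φ (Qcoarse L A z κ) := by
  funext z κ; unfold Qcoarse; exact linQ_map φ L A _ κ

/-- Naturality of `Fcoarse`. [folklore] -/
theorem Fcoarse_map (φ : 𝔸 →ₗ[ℂ] 𝔹) (L : ℕ) (A : Site d → Fin d → 𝔸) (z : Site d) :
    Fcoarse L (fun y μ => φ (A y μ)) z = φ (Fcoarse L A z) := by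
  unfold Fcoarse; exact Fhat_map φ L A _

/-- Naturality of the `m`-fold straight average `(Qcoarse L)^[m]`. [folklore] -/
theorem iterate_Qcoarse_map (φ : 𝔸 →ₗ[ℂ] 𝔹) (L : ℕ) : ∀ (m : ℕ) (A : Site d → Fin d → 𝔸),
    (Qcoarse L)^[m] (fun y μ => φ (A y μ)) = fun z κ => φ ((Qcoarse L)^[m] A z κ)
  | 0, A => rfl
  | m + 1, A => by
      rw [Function.iterate_succ_apply, Function.iterate_succ_apply, Qcoarse_map, iterate_Qcoarse_map φ L m]

/-- Naturality of the `m`-fold linearised average `(Tcoarse L)^[m]`. [folklore] -/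
theorem iterate_Tcoarse_map (φ : 𝔸 →ₗ[ℂ] 𝔹) (L : ℕ) : ∀ (m : ℕ) (A : Site d → Fin d → 𝔸),
    (Tcoarse L)^[m] (fun y μ => φ (A y μ)) = fun z κ => φ ((Tcoarse L)^[m] A z κ)
  | 0, A => rfl
  | m + 1, A => by
      have h1 : Tcoarse L (fun y μ => φ (A y μ)) = fun z κ => φ (Tcoarse L A z κ) := by
        funext z κ; exact Tcoarse_map φ L A z κ
      rw [Function.iterate_succ_apply, Function.iterate_succ_apply, h1, iterate_Tcoarse_map φ L m]

/-- Naturality of the lattice gradient `dPot`. [folklore] -/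
theorem dPot_map (φ : 𝔸 →ₗ[ℂ] 𝔹) (Φ : Site d → 𝔸) (z : Site d) (κ : Fin d) :
    dPot (fun y => φ (Φ y)) z κ = φ (dPot Φ z κ) := by
  unfold dPot; rw [map_sub]

/-- **Naturality of the accumulated frame potential `framePot`.** [folklore] -/
theorem framePot_map (φ : 𝔸 →ₗ[ℂ] 𝔹) (L : ℕ) : ∀ (k : ℕ) (A : Site d → Fin d → 𝔸) (z : Site d),
    framePot L k (fun y μ => φ (A y μ)) z = φ (framePot L k A z)
  | 0, A, z => by rw [framePot_zero, framePot_zero, map_zero]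
  | k + 1, A, z => by
      rw [framePot_succ, framePot_succ, map_add, iterate_Qcoarse_map, Fcoarse_map, framePot_map φ L k A]

end Naturality

/-! ## §2 The crude frame bound for complex-valued 1-forms -/

/-- `0 ≤ 12·Dfp d L` (the `hCF` side condition of the assembly socket). [folklore] -/
theorem twelve_mul_Dfp_nonneg (d L : ℕ) : (0 : ℝ) ≤ 12 * Dfp d L := by unfold Dfp; positivity

/-- The diagonal embedding `ℂ → Matrix (Fin 1) (Fin 1) ℂ` is an isometry for the ℓ²-operator norm. [folklore] -/
theorem norm_algebraMap_fin_one (c : ℂ) : ‖algebraMap ℂ (Matrix (Fin 1) (Fin 1) ℂ) c‖ = ‖c‖ :=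
  norm_algebraMap' _ c

/-- **THE CRUDE FRAME BOUND, COMPLEX VALUES (H4-ℂ)**: for `3 ≤ d`, `2 ≤ L`, `1 ≤ N`, `k`, and an `(L^k·N)`-periodic complex 1-form `η`,
`Σ_{z∈periodBox N} ‖framePot L k η z‖² ≤ 12·Dfp d L·Σ_{x∈periodBox (L^k·N)} Σ_κ ‖η x κ‖²` — k-FREE, N-FREE; literally the `hF` input (with
`CF = 12·Dfp d L`) of `NE3SlicePoincareAssembly.sum_norm_sq_le_of_split_interp_frame`. [folklore] -/
theorem sum_norm_framePot_sq_le_complex (hd : 3 ≤ d) {L : ℕ} (hL : 2 ≤ L) {N : ℕ} (hN : 1 ≤ N) (k : ℕ)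
    {η : Site d → Fin d → ℂ} (hη : ∀ (x : Site d) (τ μ : Fin d), η (x + ((L ^ k * N : ℕ) : ℤ) • e τ) μ = η x μ) :
    ∑ z ∈ periodBox (d := d) N, ‖framePot L k η z‖ ^ 2
      ≤ 12 * Dfp d L * ∑ x ∈ periodBox (d := d) (L ^ k * N), ∑ κ : Fin d, ‖η x κ‖ ^ 2 := by
  set φ : ℂ →ₗ[ℂ] Matrix (Fin 1) (Fin 1) ℂ := Algebra.linearMap ℂ (Matrix (Fin 1) (Fin 1) ℂ) with hφ
  have hφn : ∀ c : ℂ, ‖φ c‖ = ‖c‖ := fun c => norm_algebraMap_fin_one c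
  set Y : Site d → Fin d → Matrix (Fin 1) (Fin 1) ℂ := fun x κ => φ (η x κ) with hY
  have hYP : IsPeriodicDir Y ((L ^ k * N : ℕ) : ℤ) := fun x τ μ => by simp only [hY, hη]
  have h := sum_norm_framePot_sq_le (n := Fin 1) hd hL hN k hYP
  have e1 : ∀ z : Site d, ‖framePot L k Y z‖ = ‖framePot L k η z‖ := fun z => by
    rw [hY, framePot_map φ L k η z, hφn]
  have e2 : l2sq (periodBox (d := d) (L ^ k * N)) Y = ∑ x ∈ periodBox (d := d) (L ^ k * N), ∑ κ : Fin d, ‖η x κ‖ ^ 2 := by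
    unfold l2sq; exact Finset.sum_congr rfl fun x _ => Finset.sum_congr rfl fun κ _ => by rw [hY, hφn]
  simpa only [e1, e2] using h

end

end Summit.QuantumFields.BalabanUV.T4Continuum.NE3FramePotBoundComplex
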